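import Summits.BirchSwinnertonDyer.BirchSwinnertonDyer.Theorems.PrintCFramBottomClassIndexLawFiveLeGenusCrossingAnatomy
import Literature.NumberTheory.EllipticCurves.NonvanishingTwistsWaldspurgerOfHoffsteinLuo
import Literature.NumberTheory.EllipticCurves.BSDRootNumberModularityOnlyProofs
import Literature.NumberTheory.EllipticCurves.BSDRootNumberNoContinuationProofs
import Literature.NumberTheory.EllipticCurves.AnalyticRankOrderProofs
import Literature.NumberTheory.EllipticCurves.AnalyticRankModularityProofs
import Literature.NumberTheory.EllipticCurves.LFunctionSmulProofs
import Literature.NumberTheory.EllipticCurves.CyclotomicIwasawaMainTheoremIrreducibleBaseChangeProofs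
import HarnessLib

set_option linter.dupNamespace false

/-!
# Route `PrintCFram`, crux S3 `BottomClassIndexLawFiveLe` (item stmt-BirchSwinnertonDyer-20372), line
# `katz-genus-crossing`: STUB 1 AND THE END STATES OF THE LINE IN THE KERNEL (lead seat `bsd-line-cfram-p1`,
# g2; THEOREMS ONLY — nothing asserted about any curve, no stub closed, BSD is not proved by any of this)

Companion of `PrintCFramBottomClassIndexLawFiveLeGenusCrossingAnatomy.lean` (§1 stub 2 modulo facts, §2 the
two readings of stub 3, §4 the auxiliary-prime reciprocity). Here:

* §3 stub 1 `stub_rankZeroPrimeTwist` read two ways. (a) `stub_rankZeroPrimeTwist_of_core`: the registered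
  signature verbatim ⟸ its analytic core «∃ prime `ℓ ≡ 3 (4)`, `ℓ ∤ Δ`, `(−ℓ/p) = 1`, `L(W^{(−ℓ)}, 1) ≠ 0`»
  (model, `j`, CM, CM-ramified and `r_an = 0` are kernel bookkeeping, `twistModel_facts`); that core — PRIME
  discriminant with a residue condition at `p` — is NOT in print as stated (critic-10 #11 (P3): Ono 2001 /
  Ono–Skinner 1998 give Frobenian sets of primes with no control at `p`; the CM families Coates–Li 2020 and
  arXiv:2305.08689 Thm. 1.1 twist the Gross curve by PRODUCTS of inert primes `≡ 1 (4)`, real fields).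
  (b) `exists_heegnerField_rankZeroTwist`: the critic's REPAIR — the discriminant of an imaginary quadratic
  `K` with every prime of `N_W` split and `p` split, in place of the prime `−ℓ` — is PROVED modulo two
  refereed named facts (modularity `exists_isNewformOf`; Hoffstein–Luo 1997
  `HoffsteinLuo1997_exists_twist_L_one_ne_zero`) through the tree's
  `friedbergHoffstein_exists_heegnerField_split_twist_ne_zero_of_hoffsteinLuo`, the sign `w(W) = −1` coming
  from `r_an(W) = 1` (`even_analyticRank_iff_rootNumber_eq_one_of_exists_isNewformOf`).
* §5 END STATES, BY NAME against `Theses.PrintCFram.BottomClassIndexLawFiveLe`: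
  `crux_of_core_of_pPartOverHeegnerField` — the crux from {modularity, Burungale–Flach, Cassels, Milne} +
  stub 1's analytic core + the over-`ℚ(√−ℓ)` `p`-part (§2 (b) of the companion); `crux_of_heegnerField_pPartOver`
  — the crux from FIVE refereed named facts {`exists_isNewformOf`, Hoffstein–Luo, Burungale–Flach, Cassels,
  Milne} + ONE statement: Miller's `BSD(W/K, p)` on `W.baseChange K` for an imaginary quadratic `K`
  satisfying the Heegner hypothesis for `N_W` and for `p`, at a globally minimal `d_K`-twist of analytic rank
  `0` with `BSD_p`. GZK is the crux's own antecedent and is used, not assumed; `heegnerFieldDescent_of_facts`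
  is the descent step alone (the would-be fourth stub of a reshaped skeleton, closed modulo facts).

So, in numbers: after the repair 2 of the line's 3 stubs (S1', S2) and the assembly step are closed modulo
refereed named facts; what remains is ONE statement, `BSD(W/K, p)` over a Heegner field with `p` split, for a
curve ADDITIVE at `p` with `W[p]` REDUCIBLE — exactly `BSD(W, p)` given S2 (`pPartOverHeegnerField_iff_bsdp`),
i.e. crux-sized, and outside every printed scope (barrier `CMRankOneAtRamifiedPrime`, lists (A) `p ∤ N`,
(C) `Irr`). beyond-print theorem: NO. Supports, does not close, stmt-BirchSwinnertonDyer-20372.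

References: [HoffsteinLuo1997] Theorem (pp. 435–436); [MurtyMurty1997] Ch. 6 §1; [BCDTJAMS2001] Thm. A;
[FriedbergHoffstein1995] Thm. B; [BurungaleFlach2024] Thm. 1.1, Cor. 2; [Milne1972ArithmeticAV] §1 Thm. 1;
[DokchitserDokchitserAnnals2010] §2.1; [Miller2011LMS] Def. 1.1; [Cassels1965ArithmeticVIII];
[SilvermanAEC2009] VIII.8.3, X.5.4, C.16; [MatarNekovar2019] Thm. 6.7; barrier
`Literature/Barriers/BirchSwinnertonDyer/CMRankOneAtRamifiedPrime.lean`.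
-/

noncomputable section

open scoped Classical

open WeierstrassCurve Literature.NumberTheory.EllipticCurves Literature.NumberTheory.EllipticCurves.Rank1Residual
  Summit.BirchSwinnertonDyer.Rank1Residual Summit.BirchSwinnertonDyer.Rank1Residual.X12
  Summit.BirchSwinnertonDyer.Rank1Residual.X12.O11
  Summit.BirchSwinnertonDyer.BirchSwinnertonDyer.Theorems.RamifiedSevenEllipticUnits

namespace Summit.BirchSwinnertonDyer.BirchSwinnertonDyer.Theorems.PrintCFram.KatzGenusCrossing

/-! ### §3. Stub 1 `stub_rankZeroPrimeTwist` -/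

/-- **Kernel bookkeeping for a model of a twist.** If `C₁ • W₁ = W^{(d)}` (`d ≠ 0`) with `W` CM and
CM-ramified at `p`, then `j(W₁) = j(W)` (Silverman III.1.4(b), X.5.4: `variableChange_j`, `j_quadraticTwist`),
`W₁` is CM (the tree's class-number-one table `hasCM_iff_j_mem_holds`) and CM-ramified at `p` (`CMRamified`
is a function of `j`), and `L(W^{(d)}, 1) ≠ 0` forces `r_an(W₁) = 0` (`analyticRank_smul`; order of
vanishing `0` iff non-vanishing for an entire continuation, `analyticRank_eq_zero_iff_holds`, and `0` by
convention otherwise). [cite: SilvermanAEC2009, III.1.4(b), X.5 Prop. 5.4 and App. C §16]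
[cite: BirchSwinnertonDyer1965] -/
theorem twistModel_facts {W : WeierstrassCurve ℚ} [W.IsElliptic] {p : ℕ} {d : ℚ} (hd : d ≠ 0)
    {W₁ : WeierstrassCurve ℚ} [W₁.IsElliptic] {C₁ : VariableChange ℚ} (htw : C₁ • W₁ = W.quadraticTwist d)
    (hCM : W.HasCM) (hram : CMRamified W p) :
    W₁.j = W.j ∧ W₁.HasCM ∧ CMRamified W₁ p ∧
      ((W.quadraticTwist d).entireLFunction 1 ≠ 0 → W₁.analyticRank = 0) := by
  haveI := W.isElliptic_quadraticTwist hd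
  -- `j` carries the `IsElliptic` instance of its curve, so we transport along `htw` by substitution
  have key : ∀ (V : WeierstrassCurve ℚ) [V.IsElliptic], V = W.quadraticTwist d → V.j = W.j := by
    rintro V _ rfl
    exact j_quadraticTwist W hd
  have hj : W₁.j = W.j := by
    rw [← WeierstrassCurve.variableChange_j W₁ C₁]
    exact key _ htw
  have hCM₁ : W₁.HasCM := by
    rw [WeierstrassCurve.hasCM_iff_j_mem_holds, hj]
    exact (WeierstrassCurve.hasCM_iff_j_mem_holds W).mp hCM
  have hram₁ : CMRamified W₁ p := by
    unfold CMRamified at hram ⊢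
    rw [hj]
    exact hram
  refine ⟨hj, hCM₁, hram₁, fun hL ↦ ?_⟩
  rw [← analyticRank_smul W₁ C₁, htw]
  by_cases hE : (W.quadraticTwist d).HasEntireLFunction
  · exact (analyticRank_eq_zero_iff_holds hE).mpr hL
  · exact analyticRank_eq_zero_of_not_hasEntireLFunction _ hE

/-- **Stub 1 `stub_rankZeroPrimeTwist` (its registered signature, verbatim) ⟸ its analytic core.** If
for every CM member `W` of analytic rank one at a CM-ramified `p ≥ 5` there is a prime `ℓ ≡ 3 (mod 4)`,
`ℓ ∤ Δ_min(W)`, `(−ℓ/p) = +1`, with `L(W^{(−ℓ)}, 1) ≠ 0`, then S1 holds: a globally minimal model `W₁` of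
`W^{(−ℓ)}` exists (Silverman VIII.8.3, `exists_isGloballyMinimal_smul_eq_quadraticTwist`) and has the same
`j`, CM, the same CM-ramified `p` and analytic rank `0` (`twistModel_facts`). The displayed core — PRIME
twisting discriminant with a residue condition at `p` — is the sentence that is NOT in print as stated
(Ono 2001 Thm. 1 / Ono–Skinner 1998: Frobenian sets of primes, no control at `p`; Hoffstein–Luo /
Friedberg–Hoffstein: prescribed splitting but composite fundamental discriminants — see
`exists_heegnerField_rankZeroTwist` for that repaired form, proved). CONDITIONAL on the displayed core.
[cite: SilvermanAEC2009, VIII.8 Cor. 8.3 and X.5 Prop. 5.4] [cite: HoffsteinLuo1997, Theorem (§1, pp. 435–436)] -/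
theorem stub_rankZeroPrimeTwist_of_core
    (hcore : ∀ (W : WeierstrassCurve ℚ) [W.IsElliptic] [W.IsGloballyMinimal] (p : ℕ) [Fact p.Prime],
      W.HasCM → CMRamified W p → 5 ≤ p → W.analyticRank = 1 →
      ∃ ℓ : ℕ, ℓ.Prime ∧ ℓ % 4 = 3 ∧ ¬ ((ℓ : ℤ) ∣ W.Δ.num) ∧ legendreSym p (-(ℓ : ℤ)) = 1 ∧
        (W.quadraticTwist (-(ℓ : ℚ))).entireLFunction 1 ≠ 0) :
    ∀ (W : WeierstrassCurve ℚ) [W.IsElliptic] [W.IsGloballyMinimal] (p : ℕ) [Fact p.Prime],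
      W.HasCM → CMRamified W p → 5 ≤ p → W.analyticRank = 1 →
      ∃ (ℓ : ℕ) (W₁ : WeierstrassCurve ℚ) (_ : W₁.IsElliptic) (_ : W₁.IsGloballyMinimal) (C₁ : VariableChange ℚ),
        ℓ.Prime ∧ ℓ % 4 = 3 ∧ ¬ ((ℓ : ℤ) ∣ W.Δ.num) ∧ legendreSym p (-(ℓ : ℤ)) = 1 ∧
        C₁ • W₁ = W.quadraticTwist (-(ℓ : ℚ)) ∧ W₁.j = W.j ∧ W₁.HasCM ∧ CMRamified W₁ p ∧ W₁.analyticRank = 0 := by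
  intro W _ _ p _ hCM hram h5 hr
  obtain ⟨ℓ, hℓ, hℓ4, hgood, hleg, hL⟩ := hcore W p hCM hram h5 hr
  have he0 : (-(ℓ : ℚ)) ≠ 0 := neg_ne_zero.mpr (Nat.cast_ne_zero.mpr hℓ.ne_zero)
  obtain ⟨W₁, hE₁, hM₁, C₁, hC₁⟩ := exists_isGloballyMinimal_smul_eq_quadraticTwist W he0
  obtain ⟨hj, hCM₁, hram₁, hr₁⟩ := twistModel_facts he0 hC₁ hCM hram
  exact ⟨ℓ, W₁, hE₁, hM₁, C₁, hℓ, hℓ4, hgood, hleg, hC₁, hj, hCM₁, hram₁, hr₁ hL⟩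

/-- **The REPAIRED stub 1 (critic-10 #11 (P3): a Heegner field in place of a prime twist), PROVED modulo
two refereed named facts.** Granted modularity (`exists_isNewformOf`, BCDT 2001 Thm. A) and Hoffstein–Luo
1997 (`HoffsteinLuo1997_exists_twist_L_one_ne_zero`): for every globally minimal CM `W/ℚ` of analytic rank
one and every CM-ramified `p ≥ 5` there are an IMAGINARY QUADRATIC field `K` in which EVERY prime of the
conductor `N_W` splits (Heegner hypothesis) and `p` splits, and a globally minimal model `W₁` of the twist
`W^{(d_K)}` with `j(W₁) = j(W)`, CM, CM-ramified at `p`, of analytic rank ZERO. Proof: `r_an(W) = 1` is odd,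
so `w(W) = −1` (`even_analyticRank_iff_rootNumber_eq_one_of_exists_isNewformOf`, `rootNumber = ±1`); the
tree's `friedbergHoffstein_exists_heegnerField_split_twist_ne_zero_of_hoffsteinLuo` (Hoffstein–Luo with the
primes of `N_W` and `p` adjoined to `S`, sign of the twist forced by Murty–Murty Ch. 6 §1) gives `K` with
`L(W^{(d_K)}, 1) ≠ 0`; then `twistModel_facts`. (`5 ≤ p` is not used.) CONDITIONAL on the two facts.
[cite: HoffsteinLuo1997, Theorem (§1, pp. 435–436)] [cite: MurtyMurty1997, Ch. 6 §1, p. 96]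
[cite: BCDTJAMS2001, Thm. A] [cite: FriedbergHoffstein1995, Thm. B] [cite: SilvermanAEC2009, VIII.8 Cor. 8.3] -/
theorem exists_heegnerField_rankZeroTwist (hnf : ModularForms.exists_isNewformOf)
    (hHL : HoffsteinLuo1997_exists_twist_L_one_ne_zero) :
    ∀ (W : WeierstrassCurve ℚ) [W.IsElliptic] [W.IsGloballyMinimal] (p : ℕ) [Fact p.Prime],
      W.HasCM → CMRamified W p → 5 ≤ p → W.analyticRank = 1 →
      ∃ (K : Type) (_ : Field K) (_ : NumberField K) (W₁ : WeierstrassCurve ℚ) (_ : W₁.IsElliptic)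
        (_ : W₁.IsGloballyMinimal) (C₁ : VariableChange ℚ),
        IsImaginaryQuadratic K ∧ SatisfiesHeegnerHypothesis (W.conductorNorm ℤ) K ∧
        SatisfiesHeegnerHypothesis p K ∧ C₁ • W₁ = W.quadraticTwist (NumberField.discr K : ℚ) ∧
        W₁.j = W.j ∧ W₁.HasCM ∧ CMRamified W₁ p ∧ W₁.analyticRank = 0 := by
  intro W _ _ p _ hCM hram _h5 hr
  have hiff : Even W.analyticRank ↔ W.rootNumber = 1 :=
    even_analyticRank_iff_rootNumber_eq_one_of_exists_isNewformOf W hnf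
  have hodd : ¬ Even W.analyticRank := by
    rw [hr]
    exact Nat.not_even_one
  have hw : W.rootNumber = -1 :=
    (rootNumber_eq_one_or_eq_neg_one W).resolve_left fun h ↦ hodd (hiff.mpr h)
  have hp : p.Prime := Fact.out
  have hFH := friedbergHoffstein_exists_heegnerField_split_twist_ne_zero_of_hoffsteinLuo hnf hHL
  obtain ⟨K, hFK, hNK, hK, -, hHN, hHp, hL⟩ := hFH W hw p hp 0
  have hd0 : (NumberField.discr K : ℚ) ≠ 0 := Int.cast_ne_zero.mpr (NumberField.discr_ne_zero K)
  obtain ⟨W₁, hE₁, hM₁, C₁, hC₁⟩ := exists_isGloballyMinimal_smul_eq_quadraticTwist W hd0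
  obtain ⟨hj, hCM₁, hram₁, hr₁⟩ := twistModel_facts hd0 hC₁ hCM hram
  exact ⟨K, hFK, hNK, W₁, hE₁, hM₁, C₁, hK, hHN, hHp, hC₁, hj, hCM₁, hram₁, hr₁ hL⟩

/-! ### §5. End states: the crux BY NAME from named facts + the over-Heegner-field `p`-part -/

/-- **The DESCENT step of the repaired line, proved modulo four refereed facts** (GZK, modularity, Cassels,
Milne any-model): for a CM member `W` of analytic rank one at `p`, an imaginary quadratic `K`, and a globally
minimal model `W₁` of `W^{(d_K)}` of analytic rank `0` with `BSD(W₁, p)`, Miller's `BSD(W/K, p)` on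
`W.baseChange K` implies the analytic ramified Rubin formula `S_open(W, p)`:
`BSD(W/K,p) ∧ BSD(W₁,p) ⟹ BSD(W,p)` (`AdditivePotMult.bsdp_of_pPartOverC_baseChange`) `⟹ S_open`
(`ramifiedCMRubinFormulaAtZp_of_bsdp`). The CM hypotheses and `5 ≤ p` are not used. CONDITIONAL; closes
nothing. [cite: Milne1972ArithmeticAV, §1 Thm. 1] [cite: DokchitserDokchitserAnnals2010, §2.1 Thm. 2.3]
[cite: Miller2011LMS, Def. 1.1 (arXiv:1010.2431 p. 3)] [cite: Cassels1965ArithmeticVIII] -/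
theorem heegnerFieldDescent_of_facts (hGZK : rank_eq_analyticRank_of_analyticRank_le_one)
    (hmod : hasEntireLFunction_rat) (hCassels : bsdRHS_eq_of_isIsogenous)
    (hMilneC : Milne1972.bsdQuotient_baseChange_quadratic_anyModel) :
    ∀ (W : WeierstrassCurve ℚ) [W.IsElliptic] [W.IsGloballyMinimal] (p : ℕ) [Fact p.Prime],
      W.HasCM → CMRamified W p → 5 ≤ p → W.analyticRank = 1 →
      ∀ (K : Type) [Field K] [NumberField K] (W₁ : WeierstrassCurve ℚ) [W₁.IsElliptic] [W₁.IsGloballyMinimal]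
        (C₁ : VariableChange ℚ), IsImaginaryQuadratic K →
        C₁ • W₁ = W.quadraticTwist (NumberField.discr K : ℚ) → W₁.analyticRank = 0 → BSDp W₁ p →
        BSDpOver (W.baseChange K) p → RamifiedCMRubinFormulaAtZp W p := by
  intro W _ _ p _ _hCM _hram _h5 hr K _ _ W₁ _ _ C₁ hK htw hr₁ hB₁ hKp
  haveI : (W.baseChange K).IsElliptic := by rw [WeierstrassCurve.baseChange]; infer_instance
  have hWd : ∃ C : VariableChange ℚ, C • W.quadraticTwist (NumberField.discr K : ℚ) = W₁ :=
    ⟨C₁⁻¹, by rw [← htw, inv_smul_smul]⟩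
  have hfin := shaFinite_baseChange_of_facts hGZK hMilneC W hr.le K hK.1 W₁ (by omega) hWd
  exact RubinFormulaZpBsdp.ramifiedCMRubinFormulaAtZp_of_bsdp hCassels hmod hGZK hr.le
    (AdditivePotMult.bsdp_of_pPartOverC_baseChange W p K W₁ hGZK hmod hMilneC hr.le hK.1 hWd (by omega)
      (missingPPartOverCAt_of_bsdpOver _ p hfin hKp) hB₁)

/-- **END STATE OF THE REPAIRED LINE, BY NAME.** The crux `Theses.PrintCFram.BottomClassIndexLawFiveLe`
follows from FIVE refereed named facts — modularity `exists_isNewformOf` (BCDT 2001), Hoffstein–Luo 1997,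
Burungale–Flach 2024 Cor. 2, Cassels 1965 (`bsdRHS_eq_of_isIsogenous`), Milne 1972 any-model — and ONE
displayed statement `hOverK`: for every CM member `W` of analytic rank one at a CM-ramified `p ≥ 5`, every
imaginary quadratic `K` satisfying the Heegner hypothesis for `N_W` and for `p`, and every globally minimal
model `W₁` of `W^{(d_K)}` of analytic rank `0` with `BSD(W₁, p)`: Miller's `BSD(W/K, p)` on `W.baseChange K`.
GZK is the crux's own antecedent (used through `bottomClassIndexLawFiveLe_iff_rubinFormulaZp_of_GZK`).
Assembly: `exists_heegnerField_rankZeroTwist` (§3b) ∘ `stub_rankZeroTwistBSDp_of_facts` (§1) ∘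
`heegnerFieldDescent_of_facts`. `hOverK` is NOT in print: at such `(W, p, K)` the curve is additive at `p`
with `W[p]` reducible (barrier `CMRankOneAtRamifiedPrime`, lists (A), (C)). CONDITIONAL; nothing booked;
BSD is not proved by any of this. [cite: HoffsteinLuo1997, Theorem (§1, pp. 435–436)]
[cite: BurungaleFlach2024, Thm. 1.1 and Cor. 2] [cite: Milne1972ArithmeticAV, §1 Thm. 1]
[cite: BCDTJAMS2001, Thm. A] [cite: Cassels1965ArithmeticVIII] [cite: Miller2011LMS, Def. 1.1 (arXiv:1010.2431 p. 3)]
[cite: MatarNekovar2019, Thm. 6.7 (p. 498) (scope: irreducible E[p])] -/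
theorem crux_of_heegnerField_pPartOver (hnf : ModularForms.exists_isNewformOf)
    (hHL : HoffsteinLuo1997_exists_twist_L_one_ne_zero) (hBF : bsdTriple_of_hasCM_of_L_one_ne_zero)
    (hCassels : bsdRHS_eq_of_isIsogenous) (hMilneC : Milne1972.bsdQuotient_baseChange_quadratic_anyModel)
    (hOverK : ∀ (W : WeierstrassCurve ℚ) [W.IsElliptic] [W.IsGloballyMinimal] (p : ℕ) [Fact p.Prime],
      W.HasCM → CMRamified W p → 5 ≤ p → W.analyticRank = 1 →
      ∀ (K : Type) [Field K] [NumberField K] (W₁ : WeierstrassCurve ℚ) [W₁.IsElliptic] [W₁.IsGloballyMinimal]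
        (C₁ : VariableChange ℚ), IsImaginaryQuadratic K → SatisfiesHeegnerHypothesis (W.conductorNorm ℤ) K →
        SatisfiesHeegnerHypothesis p K → C₁ • W₁ = W.quadraticTwist (NumberField.discr K : ℚ) →
        W₁.analyticRank = 0 → BSDp W₁ p → BSDpOver (W.baseChange K) p) :
    Summit.BirchSwinnertonDyer.BirchSwinnertonDyer.Theses.PrintCFram.BottomClassIndexLawFiveLe := by
  have hmod : hasEntireLFunction_rat := hasEntireLFunction_rat_of_exists_isNewformOf hnf
  refine Summit.BirchSwinnertonDyer.Rank1Residual.PrintCfram.bottomClassIndexLawFiveLe_iff_rubinFormulaZp_of_GZK.mpr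
    fun hGZK W _ _ p _ hCM hram h5 hr ↦ ?_
  obtain ⟨K, _, _, W₁, _, _, C₁, hK, hHN, hHp, htw, -, hCM₁, hram₁, hr₁⟩ :=
    exists_heegnerField_rankZeroTwist hnf hHL W p hCM hram h5 hr
  have hB₁ : BSDp W₁ p := stub_rankZeroTwistBSDp_of_facts hBF hmod W₁ p hCM₁ hram₁ h5 hr₁
  exact heegnerFieldDescent_of_facts hGZK hmod hCassels hMilneC W p hCM hram h5 hr K W₁ C₁ hK htw hr₁ hB₁
    (hOverK W p hCM hram h5 hr K W₁ C₁ hK hHN hHp htw hr₁ hB₁)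

/-- **END STATE OF THE REGISTERED LINE, BY NAME.** The crux `Theses.PrintCFram.BottomClassIndexLawFiveLe`
follows from four refereed named facts — modularity `hasEntireLFunction_rat`, Burungale–Flach 2024 Cor. 2,
Cassels, Milne 1972 any-model — plus stub 1's analytic core `hcore` (unprinted as stated, §3a) and the
over-`ℚ(√−ℓ)` reading `hK` of stub 3 (`BSD(W/K, p)` on `W.baseChange K` for every datum of S3 and every
quadratic `K` of discriminant `−ℓ`; unprinted, §2). GZK is the crux's own antecedent. Assembly:
`stub_rankZeroPrimeTwist_of_core` ∘ `stub_rankZeroTwistBSDp_of_facts` ∘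
`stub_genusCrossing_of_pPartOverHeegnerField`. CONDITIONAL; nothing booked; BSD is not proved by any of this.
[cite: BurungaleFlach2024, Thm. 1.1 and Cor. 2] [cite: Milne1972ArithmeticAV, §1 Thm. 1]
[cite: Miller2011LMS, Def. 1.1 (arXiv:1010.2431 p. 3)] [cite: Cassels1965ArithmeticVIII] -/
theorem crux_of_core_of_pPartOverHeegnerField (hmod : hasEntireLFunction_rat)
    (hBF : bsdTriple_of_hasCM_of_L_one_ne_zero) (hCassels : bsdRHS_eq_of_isIsogenous)
    (hMilneC : Milne1972.bsdQuotient_baseChange_quadratic_anyModel)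
    (hcore : ∀ (W : WeierstrassCurve ℚ) [W.IsElliptic] [W.IsGloballyMinimal] (p : ℕ) [Fact p.Prime],
      W.HasCM → CMRamified W p → 5 ≤ p → W.analyticRank = 1 →
      ∃ ℓ : ℕ, ℓ.Prime ∧ ℓ % 4 = 3 ∧ ¬ ((ℓ : ℤ) ∣ W.Δ.num) ∧ legendreSym p (-(ℓ : ℤ)) = 1 ∧
        (W.quadraticTwist (-(ℓ : ℚ))).entireLFunction 1 ≠ 0)
    (hK : ∀ (W : WeierstrassCurve ℚ) [W.IsElliptic] [W.IsGloballyMinimal] (p : ℕ) [Fact p.Prime],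
      W.HasCM → CMRamified W p → 5 ≤ p → W.analyticRank = 1 →
      ∀ (ℓ : ℕ) (W₁ : WeierstrassCurve ℚ) [W₁.IsElliptic] [W₁.IsGloballyMinimal] (C₁ : VariableChange ℚ),
        ℓ.Prime → ℓ % 4 = 3 → ¬ ((ℓ : ℤ) ∣ W.Δ.num) → legendreSym p (-(ℓ : ℤ)) = 1 →
        C₁ • W₁ = W.quadraticTwist (-(ℓ : ℚ)) → W₁.analyticRank = 0 → BSDp W₁ p →
      ∀ (K : Type) [Field K] [NumberField K], Module.finrank ℚ K = 2 → NumberField.discr K = -(ℓ : ℤ) →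
        BSDpOver (W.baseChange K) p) :
    Summit.BirchSwinnertonDyer.BirchSwinnertonDyer.Theses.PrintCFram.BottomClassIndexLawFiveLe := by
  refine Summit.BirchSwinnertonDyer.Rank1Residual.PrintCfram.bottomClassIndexLawFiveLe_iff_rubinFormulaZp_of_GZK.mpr
    fun hGZK W _ _ p _ hCM hram h5 hr ↦ ?_
  obtain ⟨ℓ, W₁, _, _, C₁, hℓ, hℓ4, hgood, hleg, htw, -, hCM₁, hram₁, hr₁⟩ :=
    stub_rankZeroPrimeTwist_of_core hcore W p hCM hram h5 hr
  have hB₁ : BSDp W₁ p := stub_rankZeroTwistBSDp_of_facts hBF hmod W₁ p hCM₁ hram₁ h5 hr₁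
  exact stub_genusCrossing_of_pPartOverHeegnerField hGZK hmod hCassels hMilneC hK W p hCM hram h5 hr ℓ W₁ C₁ hℓ
    hℓ4 hgood hleg htw hr₁ hB₁

/-! ### §6. Exactness of the reshaped research stub (appended by the lead, g2) -/

/-- **The reshaped research stub `stub_heegnerFieldPPart` at one datum IS `BSD(W, p)` — exactness over a
general imaginary quadratic field.** For `W/ℚ` globally minimal of analytic rank `≤ 1`, an imaginary
quadratic `K`, a globally minimal model `W₁` of `W^{(d_K)}` of analytic rank `0` with `BSD(W₁, p)`: Miller's
`BSD(W/K, p)` on `W.baseChange K` ⟺ `BSD(W, p)` (granted GZK, modularity, Milne any-model: `Ш(W_K)` is finite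
by `shaFinite_baseChange_of_facts`, then cell `b2b-bsdres`'s `missingPPartOverCAt_baseChange_iff_bsdp`). The
Heegner hypotheses of the stub are not needed for this reading. So, given stub 2, stub 4 of the reshaped
skeleton (`Cruxes/BottomClassIndexLawFiveLe/Lines/katz_genus_crossing.lean`, lead g2) is pointwise exactly the
leaf instance `BSD(W, p)`: crux-sized by theorem. [cite: Milne1972ArithmeticAV, §1 Thm. 1]
[cite: Miller2011LMS, §1 and Def. 1.1 (arXiv:1010.2431 p. 3)] [cite: DokchitserDokchitserAnnals2010, §2.1 Thm. 2.3] -/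
theorem heegnerFieldPPart_iff_bsdp (hGZK : rank_eq_analyticRank_of_analyticRank_le_one)
    (hmod : hasEntireLFunction_rat) (hMilneC : Milne1972.bsdQuotient_baseChange_quadratic_anyModel)
    {W : WeierstrassCurve ℚ} [W.IsElliptic] [W.IsGloballyMinimal] {p : ℕ} [Fact p.Prime]
    (hr : W.analyticRank ≤ 1) (K : Type) [Field K] [NumberField K] (hK : IsImaginaryQuadratic K)
    {W₁ : WeierstrassCurve ℚ} [W₁.IsElliptic] [W₁.IsGloballyMinimal] {C₁ : VariableChange ℚ}
    (htw : C₁ • W₁ = W.quadraticTwist (NumberField.discr K : ℚ)) (hr₁ : W₁.analyticRank = 0)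
    (hB₁ : BSDp W₁ p) : BSDpOver (W.baseChange K) p ↔ BSDp W p := by
  haveI : (W.baseChange K).IsElliptic := by rw [WeierstrassCurve.baseChange]; infer_instance
  have hWd : ∃ C : VariableChange ℚ, C • W.quadraticTwist (NumberField.discr K : ℚ) = W₁ :=
    ⟨C₁⁻¹, by rw [← htw, inv_smul_smul]⟩
  have hfin := shaFinite_baseChange_of_facts hGZK hMilneC W hr K hK.1 W₁ (by omega) hWd
  rw [bsdpOver_iff_of_shaFinite _ p hfin]
  exact AdditivePotMult.missingPPartOverCAt_baseChange_iff_bsdp W p K W₁ hGZK hmod hMilneC hr hK.1 hWd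
    (by omega) hB₁

/-- **The reshaped descent stub `stub_heegnerFieldDescent` (its registered signature, verbatim after the
GZK antecedent) modulo three refereed named facts** — modularity, Cassels, Milne any-model: a restatement of
`heegnerFieldDescent_of_facts` with the crux's GZK antecedent in the stub's own position. CONDITIONAL on the
three displayed facts; closes nothing. [cite: Milne1972ArithmeticAV, §1 Thm. 1] [cite: Cassels1965ArithmeticVIII]
[cite: Miller2011LMS, Def. 1.1 (arXiv:1010.2431 p. 3)] -/
theorem stub_heegnerFieldDescent_of_facts (hmod : hasEntireLFunction_rat)
    (hCassels : bsdRHS_eq_of_isIsogenous) (hMilneC : Milne1972.bsdQuotient_baseChange_quadratic_anyModel) :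
    rank_eq_analyticRank_of_analyticRank_le_one →
    ∀ (W : WeierstrassCurve ℚ) [W.IsElliptic] [W.IsGloballyMinimal] (p : ℕ) [Fact p.Prime],
      W.HasCM → CMRamified W p → 5 ≤ p → W.analyticRank = 1 →
      ∀ (K : Type) [Field K] [NumberField K] (W₁ : WeierstrassCurve ℚ) [W₁.IsElliptic] [W₁.IsGloballyMinimal]
        (C₁ : VariableChange ℚ), IsImaginaryQuadratic K →
        C₁ • W₁ = W.quadraticTwist (NumberField.discr K : ℚ) → W₁.analyticRank = 0 → BSDp W₁ p →
        BSDpOver (W.baseChange K) p → RamifiedCMRubinFormulaAtZp W p :=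
  fun hGZK ↦ heegnerFieldDescent_of_facts hGZK hmod hCassels hMilneC

end Summit.BirchSwinnertonDyer.BirchSwinnertonDyer.Theorems.PrintCFram.KatzGenusCrossing

end
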